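import Summits.CriticalPhenomena.PercolationContinuityZ3.Theorems.PercAnnulusCrossingSlabThm31OfFive
import Literature.Probability.Percolation.SlabRSWProp39HighProb
import HarnessLib

/-!
# RSW3 lane (lead GEN 38): NEWMAN–TASSION–WU'S THEOREM 3.1 AT `p_c(S_k)` FROM FOUR GLUING-LAYER INPUTS —
# Prop. 3.9 (1) in the high-probability regime DISCHARGED

builds on p205010 (kernel theorem, internal audit signed; external expert review pending) — NOT used in this file.

Cell `prim-rsw3` (LANE 3), lead seat, gen 38.  Support file (`--supports stmt-CriticalPhenomena-4575`); no definitions, no named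
facts, no sorries.  The lead's `NewmanTassionWu2017_thm31_of_five` (gen 37) takes five inputs of the gluing layer; its (H39) —
NTW's Prop. 3.9 (1) in the high-probability regime, `ε-δ` form — is now a theorem of the tree
(`NTW17.prop39_one_highProb`, `Literature/…/SlabRSWProp39HighProb.lean`, via the new segment-target / top-extension gluing lemma
`glue0_highProb_segExt`).  Result: **NTW's Theorem 3.1 at `p_c(S_k)` (and the named fact `NewmanTassionWu2017_thm31`) from
FOUR inputs** — (H3) Case 3 of Theorem 3.14, (H38) Theorem 3.8 (`ε-δ`), (H310) Theorem 3.10, (H317) Theorem 3.17 at `p_c(S_k)`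
— for any `m₀ ≥ 40` (the threshold of `prop39_one_highProb`; the remaining inputs only get weaker as `m₀` grows).

* `boxCrossingProperty_slabCritical_of_four` (per `k ≥ 1`), `NewmanTassionWu2017_thm31_of_four` (every `k ≥ 1`).

References: C. M. Newman, V. Tassion, W. Wu, *Critical percolation and the minimal spanning tree in slabs*, Comm. Pure Appl. Math. 70
(2017) = arXiv:1512.09107, §3.3 (Prop. 3.9) and §3.7 (proof of Theorem 3.1) [NewmanTassionWu2017].
-/

noncomputable section

namespace Summit.CriticalPhenomena.PercolationContinuityZ3.Theorems.Crossing

open MeasureTheory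
open Literature.Probability.Percolation Literature.Probability.LatticeModels
open Literature.Probability.Percolation.NTW17

/-- **NTW's Theorem 3.1 at `p_c(S_k)` from FOUR gluing-layer inputs** ((H39) discharged by `prop39_one_highProb`): (H3)
(Case 3 of Thm 3.14 against p2's `evCase2`), (H38), (H310) on `[ε,1-ε]` for every `ε > 0`, (H317) at `p_c(S_k)`; `m₀ ≥ 40`.
[cite: NewmanTassionWu2017, Theorem 3.1 (§3.7) with Proposition 3.9 (1)] -/
theorem boxCrossingProperty_slabCritical_of_four (k : ℕ) (hk : 1 ≤ k) {ρ₂ : ℕ} (hρ₂ : 2 ≤ ρ₂) {m₀ : ℕ} (hm₀ : 40 ≤ m₀)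
    (hCase3 : ∀ x : ℝ, 0 < x → ∃ y : ℝ, 0 < y ∧ ∃ n₃ : ℕ, ∀ n : ℕ, n₃ ≤ n →
      x ≤ (bondPercolation (slabGraph 3 k) (criticalProbIOf (slabGraph 3 k) (slabOrigin 3 k))).real
        ((slabConn k (boxR 0 (7 * n) 0 (8 * n - 1)) {z | z.1 = 0} (sideSeg (7 * n) 0 (4 * n - 1)) ∩
            slabConn k (boxR (-(7 * n)) (7 * n) 0 (13 * n - 1)) {z | z.2 = 0} (sideSeg (7 * n) (5 * n) (13 * n - 1))) ∩
          (slabConn k (boxR (-(7 * n)) (7 * n) 0 (13 * n - 1)) (sideSeg (7 * n) (5 * n) (13 * n - 1))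
            (sideSeg (7 * n) 0 (4 * n - 1)))ᶜ ∩ (NTW17.evCase2 k ρ₂ n)ᶜ) →
      y ≤ (bondPercolation (slabGraph 3 k) (criticalProbIOf (slabGraph 3 k) (slabOrigin 3 k))).real
        (slabConn k (boxR 0 (14 * n) 0 (13 * n)) {z | z.1 = 0} {z | z.1 = 14 * n}))
    (h38 : ∀ ε : ℝ, 0 < ε → ∀ η : ℝ, 0 < η → ∃ δ : ℝ, 0 < δ ∧ ∀ p : unitInterval, ε ≤ (p : ℝ) → (p : ℝ) ≤ 1 - ε →
      ∀ m n : ℕ, m₀ ≤ m → m ≤ n → ∀ (z : ℤ × ℤ) (i : Fin 2),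
      1 - δ ≤ crossingProb k p (3 * n) (2 * m) →
      1 - δ ≤ (bondPercolation (slabGraph 3 k) p).real (circuitAround k z m n) →
      1 - δ ≤ (bondPercolation (slabGraph 3 k) p).real (circuitAround k (z + coarseShift (3 * n) i) m n) →
      1 - η ≤ (bondPercolation (slabGraph 3 k) p).real (linkEvent k z m n i))
    (h310 : ∀ ε : ℝ, 0 < ε → ∀ c : ℝ, 0 < c → ∃ lam : ℕ, 1 ≤ lam ∧ ∃ c' : ℝ, 0 < c' ∧ ∀ p : unitInterval,
      ε ≤ (p : ℝ) → (p : ℝ) ≤ 1 - ε → ∀ n : ℕ, m₀ ≤ n → c ≤ crossingProb k p (2 * n) (n - 1) →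
      ∀ z : ℤ × ℤ, c' ≤ (bondPercolation (slabGraph 3 k) p).real (circuitAround k z (lam * n) (2 * (lam * n))))
    (h317 : ∀ η : ℝ, 0 < η →
      (∀ δ : ℝ, 0 < δ → ∃ n : ℕ, 1 ≤ n ∧
        1 - δ ≤ crossingProb k (criticalProbIOf (slabGraph 3 k) (slabOrigin 3 k)) n (2 * n)) →
      ∃ n : ℕ, m₀ ≤ n ∧
        1 - η ≤ crossingProb k (criticalProbIOf (slabGraph 3 k) (slabOrigin 3 k)) (2 * n) (n - 1)) :
    BoxCrossingProperty k (criticalProbIOf (slabGraph 3 k) (slabOrigin 3 k)) :=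
  boxCrossingProperty_slabCritical_of_five k hk hρ₂ (le_trans (by norm_num) hm₀) hCase3 h38 h310
    (fun _ε hε _η hη j _hj => prop39_one_highProb k hk hε hη j hm₀) h317

/-- **`NewmanTassionWu2017_thm31` from four gluing-layer inputs** (for every `k ≥ 1`; `m₀ ≥ 40`).
[cite: NewmanTassionWu2017, Theorem 3.1 and §3.7, with Proposition 3.9 (1)] -/
theorem NewmanTassionWu2017_thm31_of_four {ρ₂ : ℕ} (hρ₂ : 2 ≤ ρ₂) {m₀ : ℕ} (hm₀ : 40 ≤ m₀)
    (hCase3 : ∀ k : ℕ, 1 ≤ k → ∀ x : ℝ, 0 < x → ∃ y : ℝ, 0 < y ∧ ∃ n₃ : ℕ, ∀ n : ℕ, n₃ ≤ n →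
      x ≤ (bondPercolation (slabGraph 3 k) (criticalProbIOf (slabGraph 3 k) (slabOrigin 3 k))).real
        ((slabConn k (boxR 0 (7 * n) 0 (8 * n - 1)) {z | z.1 = 0} (sideSeg (7 * n) 0 (4 * n - 1)) ∩
            slabConn k (boxR (-(7 * n)) (7 * n) 0 (13 * n - 1)) {z | z.2 = 0} (sideSeg (7 * n) (5 * n) (13 * n - 1))) ∩
          (slabConn k (boxR (-(7 * n)) (7 * n) 0 (13 * n - 1)) (sideSeg (7 * n) (5 * n) (13 * n - 1))
            (sideSeg (7 * n) 0 (4 * n - 1)))ᶜ ∩ (NTW17.evCase2 k ρ₂ n)ᶜ) →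
      y ≤ (bondPercolation (slabGraph 3 k) (criticalProbIOf (slabGraph 3 k) (slabOrigin 3 k))).real
        (slabConn k (boxR 0 (14 * n) 0 (13 * n)) {z | z.1 = 0} {z | z.1 = 14 * n}))
    (h38 : ∀ k : ℕ, 1 ≤ k → ∀ ε : ℝ, 0 < ε → ∀ η : ℝ, 0 < η → ∃ δ : ℝ, 0 < δ ∧ ∀ p : unitInterval,
      ε ≤ (p : ℝ) → (p : ℝ) ≤ 1 - ε → ∀ m n : ℕ, m₀ ≤ m → m ≤ n → ∀ (z : ℤ × ℤ) (i : Fin 2),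
      1 - δ ≤ crossingProb k p (3 * n) (2 * m) →
      1 - δ ≤ (bondPercolation (slabGraph 3 k) p).real (circuitAround k z m n) →
      1 - δ ≤ (bondPercolation (slabGraph 3 k) p).real (circuitAround k (z + coarseShift (3 * n) i) m n) →
      1 - η ≤ (bondPercolation (slabGraph 3 k) p).real (linkEvent k z m n i))
    (h310 : ∀ k : ℕ, 1 ≤ k → ∀ ε : ℝ, 0 < ε → ∀ c : ℝ, 0 < c → ∃ lam : ℕ, 1 ≤ lam ∧ ∃ c' : ℝ, 0 < c' ∧
      ∀ p : unitInterval, ε ≤ (p : ℝ) → (p : ℝ) ≤ 1 - ε → ∀ n : ℕ, m₀ ≤ n → c ≤ crossingProb k p (2 * n) (n - 1) →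
      ∀ z : ℤ × ℤ, c' ≤ (bondPercolation (slabGraph 3 k) p).real (circuitAround k z (lam * n) (2 * (lam * n))))
    (h317 : ∀ k : ℕ, 1 ≤ k → ∀ η : ℝ, 0 < η →
      (∀ δ : ℝ, 0 < δ → ∃ n : ℕ, 1 ≤ n ∧
        1 - δ ≤ crossingProb k (criticalProbIOf (slabGraph 3 k) (slabOrigin 3 k)) n (2 * n)) →
      ∃ n : ℕ, m₀ ≤ n ∧
        1 - η ≤ crossingProb k (criticalProbIOf (slabGraph 3 k) (slabOrigin 3 k)) (2 * n) (n - 1)) :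
    NewmanTassionWu2017_thm31 :=
  fun k hk => boxCrossingProperty_slabCritical_of_four k hk hρ₂ hm₀ (hCase3 k hk) (h38 k hk) (h310 k hk) (h317 k hk)

end Summit.CriticalPhenomena.PercolationContinuityZ3.Theorems.Crossing

end
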